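import Summits.QuantumFields.YangMills.Theorems.PoincareLipschitzMinimiserMonotonicity
import Literature.Analysis.PDE.HarmonicMapMinimisers
import HarnessLib

/-!
# Crux `BlockLipschitzL` (stmt-QuantumFields-23533) ∕ `HistoryTailL` (stmt-QuantumFields-19936), LINE 25 «CompactnessTransfer»,
# S1″ — THE DOOR BY NAME «S1″ FROM TWO NAMED PRINTED FACTS»

Cell `ym3-torus` (YM ladder rung R3 = continuum SU(2) Yang–Mills on T³ — a RUNG, NOT the Clay problem: not d = 4, not
infinite volume, not a mass gap); WIDTH helper seat `ym-ust-19936-w3` g15 (LEAD ★w1-19936 g10 «GO (VEND)» 13:46:54Z).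
Helper `--supports stmt-QuantumFields-23533`; THEOREMS ONLY (0 `def`, 0 `sorry`, default heartbeats).

The registered stub S1″ `stub_uniformSmallScaleEnergy` (uniform small-scale energy for `W^{1,2}` local minimisers
`Q → S³`, v1.4-band text) from the two Literature NAMED FACTS of ✓`Literature/Analysis/PDE/HarmonicMapMinimisers.lean`:
`Literature.Analysis.PDE.MinimisingMapCompactness` [Luckhaus1988; Simon1996 §2.9 Lemma 1] and
`Literature.Analysis.PDE.MinimisingMapSmoothness` [SchoenUhlenbeck1984] — the third classical input, the monotonicity
formula [Simon1996 §2.4 (ii)], being the tree theorem ✓`PoincareLipschitzMinimiserMonotonicity.hMono_holds` (inner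
variations: w2 g13 (α)(β)(γ)(δ1), this seat letters∕(δ2)∕knit).  The facts' statements are the knit's hypothesis rows
(C)∕(RS) token for token, so the proofs are one application each.

WHAT IS PROVED (ns `…Theorems.PoincareLipschitzUniformSmallScaleEnergyOfFacts`).
* ★★★ `uniformSmallScaleEnergy_of_facts (hC) (hR) : ⟨S1pp, the ∀Λ Sobolev text⟩`;
* ★★★ `uniformSmallScaleEnergy_band_of_facts (hC) (hR) : ⟨registered v1.4-band `stub_uniformSmallScaleEnergy` VERBATIM⟩`.
HONEST SCOPE.  CONDITIONAL on two named printed facts (not proved in the tree); S1″ is therefore NOT closed on the registry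
(a registry close is hypothesis-free); S2♭″, `hHalvingBand`, K1, `MeanDeviationL`, `BlockLipschitzL`, `HistoryTailL` NOT proved.
YM₃ on T³ is rung R3, not Clay; YM gap NOT proved; no summit statement is proved here.
-/

set_option autoImplicit false

noncomputable section

open scoped BigOperators Topology
open MeasureTheory Set Filter Metric

namespace Summit.QuantumFields.YangMills.Theorems.PoincareLipschitzUniformSmallScaleEnergyOfFacts

open Summit.QuantumFields.YangMills.Theorems.PoincareLipschitzMinimiserMonotonicity (hMono_holds hReg_of_smooth
  uniformSmallScaleEnergy_band_of_compactness_smoothness)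
open Summit.QuantumFields.YangMills.Theorems.PoincareLipschitzUniformSmallScaleEnergyOfRows (uniformSmallScaleEnergy_of_rows)

/-- ★★★ **S1″ (∀Λ Sobolev text) FROM THE TWO NAMED FACTS** `MinimisingMapCompactness` [Simon1996 §2.9 Lemma 1; Luckhaus1988] and
`MinimisingMapSmoothness` [SchoenUhlenbeck1984], the monotonicity row being the theorem `hMono_holds`.
[cite: Simon1996, §2.9 Lemma 1; SchoenUhlenbeck1984, Theorem (n ≤ d(k))] -/
theorem uniformSmallScaleEnergy_of_facts (hC : Literature.Analysis.PDE.MinimisingMapCompactness)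
    (hR : Literature.Analysis.PDE.MinimisingMapSmoothness) :
    ∀ (Λ ε : ℝ), 0 < Λ → 0 < ε → ∃ r₁ : ℝ, 0 < r₁ ∧ r₁ ≤ 1 / 8 ∧
      ∀ (hQ : IsOpen {x : EuclideanSpace ℝ (Fin 3) | ∀ i : Fin 3, |x i| < 1}) (U : EuclideanSpace ℝ (Fin 3) → EuclideanSpace ℝ (Fin 4)) (G : EuclideanSpace ℝ (Fin 3) → (EuclideanSpace ℝ (Fin 3) →L[ℝ] EuclideanSpace ℝ (Fin 4))),
      Literature.Analysis.FunctionSpaces.HasWeakFDerivOn ⟨{x : EuclideanSpace ℝ (Fin 3) | ∀ i : Fin 3, |x i| < 1}, hQ⟩ volume U G →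
      (∀ x : EuclideanSpace ℝ (Fin 3), (∀ i : Fin 3, |x i| < 1) → ‖U x‖ = 1) →
      MeasureTheory.IntegrableOn (fun x => ∑ i : Fin 3, ‖G x (EuclideanSpace.single i (1:ℝ))‖ ^ 2)
        {x : EuclideanSpace ℝ (Fin 3) | ∀ i : Fin 3, |x i| < 1} →
      (∀ (V : EuclideanSpace ℝ (Fin 3) → EuclideanSpace ℝ (Fin 4)) (GV : EuclideanSpace ℝ (Fin 3) → (EuclideanSpace ℝ (Fin 3) →L[ℝ] EuclideanSpace ℝ (Fin 4))) (s : ℝ), s < 1 →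
        Literature.Analysis.FunctionSpaces.HasWeakFDerivOn ⟨{x : EuclideanSpace ℝ (Fin 3) | ∀ i : Fin 3, |x i| < 1}, hQ⟩ volume V GV →
        (∀ x : EuclideanSpace ℝ (Fin 3), (∀ i : Fin 3, |x i| < 1) → ‖V x‖ = 1) →
        MeasureTheory.IntegrableOn (fun x => ∑ i : Fin 3, ‖GV x (EuclideanSpace.single i (1:ℝ))‖ ^ 2)
        {x : EuclideanSpace ℝ (Fin 3) | ∀ i : Fin 3, |x i| < 1} →
        (∀ x : EuclideanSpace ℝ (Fin 3), (∃ i : Fin 3, s ≤ |x i|) → V x = U x) →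
        ∫ x in {x : EuclideanSpace ℝ (Fin 3) | ∀ i : Fin 3, |x i| < 1}, ∑ i : Fin 3, ‖G x (EuclideanSpace.single i (1:ℝ))‖ ^ 2 ≤
          ∫ x in {x : EuclideanSpace ℝ (Fin 3) | ∀ i : Fin 3, |x i| < 1}, ∑ i : Fin 3, ‖GV x (EuclideanSpace.single i (1:ℝ))‖ ^ 2) →
      ∫ x in {x : EuclideanSpace ℝ (Fin 3) | ∀ i : Fin 3, |x i| < 1}, ∑ i : Fin 3, ‖G x (EuclideanSpace.single i (1:ℝ))‖ ^ 2 ≤ Λ →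
      ∀ r : ℝ, 0 < r → r ≤ r₁ →
        ∫ x in {x : EuclideanSpace ℝ (Fin 3) | ∀ i : Fin 3, |x i| < r}, ∑ i : Fin 3, ‖G x (EuclideanSpace.single i (1:ℝ))‖ ^ 2 ≤ ε * r :=
  uniformSmallScaleEnergy_of_rows hMono_holds hC (hReg_of_smooth hR)

/-- ★★★ **THE REGISTERED S1″ TEXT FROM THE TWO NAMED FACTS** (v1.4-band `stub_uniformSmallScaleEnergy`, VERBATIM).
[cite: Simon1996, §2.9 Lemma 1; SchoenUhlenbeck1984, Theorem (n ≤ d(k))] -/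
theorem uniformSmallScaleEnergy_band_of_facts (hC : Literature.Analysis.PDE.MinimisingMapCompactness)
    (hR : Literature.Analysis.PDE.MinimisingMapSmoothness) :
    ∀ (Λ ε : ℝ), 0 < Λ → Λ ≤ 21 → 0 < ε → ∃ r₁ : ℝ, 0 < r₁ ∧ r₁ ≤ 1 / 8 ∧
      ∀ (hQ : IsOpen {x : EuclideanSpace ℝ (Fin 3) | ∀ i : Fin 3, |x i| < 1}) (U : EuclideanSpace ℝ (Fin 3) → EuclideanSpace ℝ (Fin 4)) (G : EuclideanSpace ℝ (Fin 3) → (EuclideanSpace ℝ (Fin 3) →L[ℝ] EuclideanSpace ℝ (Fin 4))),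
      Literature.Analysis.FunctionSpaces.HasWeakFDerivOn ⟨{x : EuclideanSpace ℝ (Fin 3) | ∀ i : Fin 3, |x i| < 1}, hQ⟩ volume U G →
      (∀ x : EuclideanSpace ℝ (Fin 3), (∀ i : Fin 3, |x i| < 1) → ‖U x‖ = 1) →
      MeasureTheory.IntegrableOn (fun x => ∑ i : Fin 3, ‖G x (EuclideanSpace.single i (1:ℝ))‖ ^ 2)
        {x : EuclideanSpace ℝ (Fin 3) | ∀ i : Fin 3, |x i| < 1} →
      (∀ (V : EuclideanSpace ℝ (Fin 3) → EuclideanSpace ℝ (Fin 4)) (GV : EuclideanSpace ℝ (Fin 3) → (EuclideanSpace ℝ (Fin 3) →L[ℝ] EuclideanSpace ℝ (Fin 4))) (s : ℝ), s < 1 →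
        Literature.Analysis.FunctionSpaces.HasWeakFDerivOn ⟨{x : EuclideanSpace ℝ (Fin 3) | ∀ i : Fin 3, |x i| < 1}, hQ⟩ volume V GV →
        (∀ x : EuclideanSpace ℝ (Fin 3), (∀ i : Fin 3, |x i| < 1) → ‖V x‖ = 1) →
        MeasureTheory.IntegrableOn (fun x => ∑ i : Fin 3, ‖GV x (EuclideanSpace.single i (1:ℝ))‖ ^ 2)
        {x : EuclideanSpace ℝ (Fin 3) | ∀ i : Fin 3, |x i| < 1} →
        (∀ x : EuclideanSpace ℝ (Fin 3), (∃ i : Fin 3, s ≤ |x i|) → V x = U x) →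
        ∫ x in {x : EuclideanSpace ℝ (Fin 3) | ∀ i : Fin 3, |x i| < 1}, ∑ i : Fin 3, ‖G x (EuclideanSpace.single i (1:ℝ))‖ ^ 2 ≤
          ∫ x in {x : EuclideanSpace ℝ (Fin 3) | ∀ i : Fin 3, |x i| < 1}, ∑ i : Fin 3, ‖GV x (EuclideanSpace.single i (1:ℝ))‖ ^ 2) →
      ∫ x in {x : EuclideanSpace ℝ (Fin 3) | ∀ i : Fin 3, |x i| < 1}, ∑ i : Fin 3, ‖G x (EuclideanSpace.single i (1:ℝ))‖ ^ 2 ≤ Λ →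
      ∀ r : ℝ, 0 < r → r ≤ r₁ →
        ∫ x in {x : EuclideanSpace ℝ (Fin 3) | ∀ i : Fin 3, |x i| < r}, ∑ i : Fin 3, ‖G x (EuclideanSpace.single i (1:ℝ))‖ ^ 2 ≤ ε * r :=
  uniformSmallScaleEnergy_band_of_compactness_smoothness hC hR

end Summit.QuantumFields.YangMills.Theorems.PoincareLipschitzUniformSmallScaleEnergyOfFacts

end
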